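import Literature.NumberTheory.EllipticCurves.TorsionGaloisRepMatrixProofs
import Literature.NumberTheory.GaloisRepresentations.GL2ModFourNonsplitCartanData
import HarnessLib

/-!
# `E[2] ⊂ E[4]`: `ρ̄_{E,4}` modulo `2` is `ρ̄_{E,2}` (matrix form; proofs only)

`Proofs`-style companion (one bookkeeping definition `liftP4`, theorems otherwise; no facts, no
instance; D-0014/D-0026) of `TorsionGaloisRepMatrixProofs` (§3 there does `E[4] ⊂ E[8]`), at the
level pair `(4, 2)`: for an elliptic curve `E/K` and a frame `e : E[4] ≃+ (ℤ/4)²`,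
`exists_rhoMat_eq_add_two_mul_of_two` — if `ρ̄_{E,2}` is onto then every invertible matrix over
`ℤ/4` is congruent modulo `2` to some `rhoMat e σ` — and its parity form
`exists_par_rhoMat_eq_of_two`: every `p ∈ GL₂(𝔽₂)` is `GL2Mod4.par (rhoMat e σ)` for some `σ`,
which is hypothesis (L2) of `GL2Mod4.surjective_or_conj_subset_HH` /
`GL2Mod4.surjective_of_trace_two_det_three` (Dokchitser–Dokchitser 2012, proof of Theorem (2):
"the image of `Gal(ℚ̄/ℚ)` in `GL₂(ℤ/4ℤ)` … surjects onto `GL₂(ℤ/2ℤ)`").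

## References

* [DokchitserDokchitserMathZ2012] T. Dokchitser, V. Dokchitser, *Surjectivity of mod `2ⁿ`
  representations of elliptic curves*, Math. Z. 272 (2012) 961–964, proof of Theorem (2).
* [SilvermanAEC2009] J. H. Silverman, *The Arithmetic of Elliptic Curves*, GTM 106, III.6.4, III.7.
-/

set_option autoImplicit false

noncomputable section

open scoped Classical

open Matrix WeierstrassCurve

namespace Literature.NumberTheory.EllipticCurves.DokchitserDokchitser2012

open Literature.NumberTheory.GaloisRepresentations.GL2Mod8 (P4 P4.det)
open Literature.NumberTheory.GaloisRepresentations.GL2Mod4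

universe u

variable {K : Type u} [Field K] (W : WeierstrassCurve K)

section Four

variable (e : geomTorsion W 4 ≃+ (Fin 2 → ZMod 4))

/-! ### §1. `E[2] = 2·E[4] ⊂ E[4]` -/

/-- `E[2] ⊆ E[4]`. [cite: SilvermanAEC2009, III.§6 (definition of E[m])] -/
theorem mem_geomTorsion_four_of_two {P : geomPoints W} (h : P ∈ geomTorsion W 2) :
    P ∈ geomTorsion W 4 := by
  have h2 : 2 • P = 0 := (AddSubgroup.torsionBy.nsmul_iff (A := geomPoints W) (n := 2)).mp h
  apply (AddSubgroup.torsionBy.nsmul_iff (A := geomPoints W) (n := 4)).mpr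
  rw [show (4 : ℕ) = 2 * 2 from rfl, ← smul_smul, h2, smul_zero]

/-- Membership in `E[2]` of an element of `E[4]`: `2 • P = 0`.
[cite: SilvermanAEC2009, III.§6 (definition of E[m])] -/
theorem mem_two_iff (P : geomTorsion W 4) : (P : geomPoints W) ∈ geomTorsion W 2 ↔ 2 • P = 0 := by
  rw [Subtype.ext_iff, AddSubmonoidClass.coe_nsmul, ZeroMemClass.coe_zero]
  exact AddSubgroup.torsionBy.nsmul_iff (A := geomPoints W) (n := 2)

/-- `2 • P = 0 ↔ 2 • e P = 0`. [cite: SilvermanAEC2009, Cor. III.6.4(b) (E[m] ≅ ℤ/mℤ × ℤ/mℤ)] -/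
theorem two_nsmul_eq_zero_iff (P : geomTorsion W 4) : 2 • P = 0 ↔ 2 • e P = 0 := by
  rw [← map_nsmul, e.map_eq_zero_iff]

/-- `2x = 0 ⟹ x ∈ 2ℤ/4`. [folklore] -/
private theorem exists_eq_two_mul_of_two_mul {x : ZMod 4} (h : 2 * x = 0) :
    ∃ y : ZMod 4, x = 2 * y := by
  revert x; decide

/-- `2x = 2y ⟹ x ≡ y (mod 2)`. [folklore] -/
private theorem exists_eq_add_two_mul {x y : ZMod 4} (h : 2 * x = 2 * y) :
    ∃ t : ZMod 4, x = y + 2 * t := by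
  revert x y; decide

/-- `red (x + 2t) = red x`. [folklore] -/
private theorem red_add_two_mul (x t : ZMod 4) : red (x + 2 * t) = red x := by
  revert x t; decide

/-- In `(ℤ/4)²`, `2 • v = 0` iff `v = 2 • c` for some `c`. [folklore] -/
private theorem exists_eq_two_nsmul_of_two {v : Fin 2 → ZMod 4} (h : 2 • v = 0) :
    ∃ c : Fin 2 → ZMod 4, v = 2 • c := by
  have h0 : 2 * v 0 = 0 := by simpa [nsmul_eq_mul] using congr_fun h 0
  have h1 : 2 * v 1 = 0 := by simpa [nsmul_eq_mul] using congr_fun h 1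
  obtain ⟨c0, hc0⟩ := exists_eq_two_mul_of_two_mul h0
  obtain ⟨c1, hc1⟩ := exists_eq_two_mul_of_two_mul h1
  refine ⟨![c0, c1], ?_⟩
  ext i
  fin_cases i <;> simp [nsmul_eq_mul, hc0, hc1]

/-- Every `P ∈ E[2]` is `e⁻¹(2c)`. [cite: SilvermanAEC2009, Cor. III.6.4(b) (E[m] ≅ ℤ/mℤ × ℤ/mℤ)] -/
theorem exists_eq_symm_two_nsmul_of_two {P : geomTorsion W 4} (hP : 2 • P = 0) :
    ∃ c : Fin 2 → ZMod 4, P = e.symm (2 • c) := by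
  obtain ⟨c, hc⟩ := exists_eq_two_nsmul_of_two ((two_nsmul_eq_zero_iff W e P).mp hP)
  exact ⟨c, e.injective (by rw [e.apply_symm_apply, hc])⟩

/-- `e⁻¹(2c) ∈ E[2]`. [cite: SilvermanAEC2009, Cor. III.6.4(b) (E[m] ≅ ℤ/mℤ × ℤ/mℤ)] -/
theorem two_nsmul_symm_two_nsmul (c : Fin 2 → ZMod 4) : 2 • e.symm (2 • c) = 0 := by
  have h4 : ((2 * 2 : ℕ) : ZMod 4) = 0 := by decide
  rw [two_nsmul_eq_zero_iff W e, e.apply_symm_apply, smul_smul]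
  ext i
  rw [Pi.smul_apply, Pi.zero_apply, nsmul_eq_mul, h4, zero_mul]

/-- The restriction of an additive automorphism of `E[4]` to `E[2]`. Silverman, *AEC*, III.7.
[folklore] -/
def restrictTwo (β : geomTorsion W 4 ≃+ geomTorsion W 4) : geomTorsion W 2 ≃+ geomTorsion W 2 where
  toFun P := ⟨(β ⟨P, mem_geomTorsion_four_of_two W P.2⟩ : geomPoints W), by
    rw [mem_two_iff, ← map_nsmul, β.map_eq_zero_iff, Subtype.ext_iff, AddSubmonoidClass.coe_nsmul]
    exact (AddSubgroup.torsionBy.nsmul_iff (A := geomPoints W) (n := 2)).mp P.2⟩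
  invFun P := ⟨(β.symm ⟨P, mem_geomTorsion_four_of_two W P.2⟩ : geomPoints W), by
    rw [mem_two_iff, ← map_nsmul, β.symm.map_eq_zero_iff, Subtype.ext_iff,
      AddSubmonoidClass.coe_nsmul]
    exact (AddSubgroup.torsionBy.nsmul_iff (A := geomPoints W) (n := 2)).mp P.2⟩
  left_inv P := by apply Subtype.ext; simp
  right_inv P := by apply Subtype.ext; simp
  map_add' P Q := by
    apply Subtype.ext
    change ((β _ : geomTorsion W 4) : geomPoints W) = (β _ : geomPoints W) + (β _ : geomPoints W)
    rw [← AddSubgroup.coe_add, ← map_add]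
    rfl

/-- Unfolding `restrictTwo`. [cite: SilvermanAEC2009, III.7 (E[m] and its automorphisms)] -/
theorem coe_restrictTwo (β : geomTorsion W 4 ≃+ geomTorsion W 4) (P : geomTorsion W 2) :
    (restrictTwo W β P : geomPoints W) = β ⟨P, mem_geomTorsion_four_of_two W P.2⟩ := rfl

/-! ### §2. `ρ̄₂` onto ⟹ every invertible matrix over `ℤ/4` is `≡ rhoMat σ (mod 2)` -/

/-- **`ρ̄₂` onto ⟹ `ρ̄₄` onto modulo `2`**: every invertible matrix over `ℤ/4` is congruent modulo `2`
to some `rhoMat σ` (the matrix of `σ` on `E[2] = 2·E[4]` in the basis `2e⁻¹δ₀, 2e⁻¹δ₁` is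
`rhoMat σ mod 2`). [cite: DokchitserDokchitserMathZ2012, proof of Theorem (2) (the image in GL₂(ℤ/4ℤ) surjects onto GL₂(ℤ/2ℤ))] -/
theorem exists_rhoMat_eq_add_two_mul_of_two (h2 : W.HasSurjectiveModNGaloisRep 2) (g : M4)
    (hg : g.det * g.det = 1) :
    ∃ (σ : Field.absoluteGaloisGroup K) (T : M4), rhoMat W e σ = g + 2 * T := by
  obtain ⟨σ, hσ⟩ := h2 (Multiplicative.ofAdd (restrictTwo W (toAut e g g.det hg)))
  -- `σ` acts on `E[2] = 2·E[4]` as `toAut g`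
  have hact : ∀ c : Fin 2 → ZMod 4, e (σ • e.symm (2 • c)) = g *ᵥ (2 • c) := by
    intro c
    set P : geomTorsion W 4 := e.symm (2 • c) with hP
    have hP2 : (P : geomPoints W) ∈ geomTorsion W 2 := (mem_two_iff W P).mpr
      (two_nsmul_symm_two_nsmul W e c)
    have h1 := congrArg (fun β ↦ ((β.toAdd ⟨P, hP2⟩ : geomTorsion W 2) : geomPoints W)) hσ
    simp only [toAdd_ofAdd, galoisRepTorsion_apply, AddSubgroup.torsionBy.coe_smul,
      coe_restrictTwo] at h1
    have h2' : σ • P = toAut e g g.det hg P := Subtype.ext h1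
    rw [h2', apply_toAut, hP, e.apply_symm_apply]
  -- compare columns: `2 • rhoMat σ δ_j = 2 • g δ_j`
  have hcol : ∀ i j, 2 * rhoMat W e σ i j = 2 * g i j := by
    intro i j
    have h := hact (Pi.single j 1)
    rw [rhoMat_mulVec, e.apply_symm_apply, Matrix.mulVec_smul, Matrix.mulVec_smul] at h
    have h' := congr_fun h i
    simp only [Pi.smul_apply, nsmul_eq_mul, Nat.cast_ofNat, Matrix.mulVec, dotProduct,
      Pi.single_apply, Fin.sum_univ_two] at h'
    fin_cases j <;> simpa using h'
  choose T hT using fun i j ↦ exists_eq_add_two_mul (hcol i j)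
  refine ⟨σ, Matrix.of fun i j ↦ T i j, ?_⟩
  ext i j
  rw [hT i j]
  simp [Matrix.mul_apply, Matrix.ofNat_apply]

/-- Parity form: if `ρ̄₂` is onto, the reduction of every invertible `g` over `ℤ/4` is the reduction
of some `rhoMat σ`. [cite: DokchitserDokchitserMathZ2012, proof of Theorem (2) (the image in GL₂(ℤ/4ℤ) surjects onto GL₂(ℤ/2ℤ))] -/
theorem exists_par_rhoMat_eq_par_of_two (h2 : W.HasSurjectiveModNGaloisRep 2) (g : M4)
    (hg : g.det * g.det = 1) :
    ∃ σ : Field.absoluteGaloisGroup K, par (rhoMat W e σ) = par g := by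
  obtain ⟨σ, T, h⟩ := exists_rhoMat_eq_add_two_mul_of_two W e h2 g hg
  refine ⟨σ, ?_⟩
  have hij : ∀ i j, rhoMat W e σ i j = g i j + 2 * T i j := by
    intro i j
    rw [h]
    simp [Matrix.mul_apply, Matrix.ofNat_apply]
  show (red (rhoMat W e σ 0 0), red (rhoMat W e σ 0 1), red (rhoMat W e σ 1 0),
      red (rhoMat W e σ 1 1)) = (red (g 0 0), red (g 0 1), red (g 1 0), red (g 1 1))
  simp only [hij, red_add_two_mul]

/-- A lift `𝔽₂ → ℤ/4` of a bit (`0 ↦ 0`, `1 ↦ 1`), entrywise on parity matrices. [folklore] -/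
def liftP4 (p : P4) : Q4 :=
  (if p.1 = 0 then 0 else 1, if p.2.1 = 0 then 0 else 1, if p.2.2.1 = 0 then 0 else 1,
    if p.2.2.2 = 0 then 0 else 1)

/-- `par (liftP4 p) = p`, and `liftP4 p` is invertible when `det p = 1`. [cite: DokchitserDokchitserMathZ2012, proof of Theorem (2) (computation in GL₂(ℤ/4ℤ))] -/
theorem liftP4_facts : (∀ p : P4, Q4.par (liftP4 p) = p) ∧
    ∀ p : P4, P4.det p = 1 → Q4.det (liftP4 p) * Q4.det (liftP4 p) = 1 := by
  refine ⟨by decide, by decide⟩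

/-- **(L2) for `ρ̄₄` from `ρ̄₂` onto**: every element of `GL₂(𝔽₂)` is the reduction of some
`rhoMat e σ`. [cite: DokchitserDokchitserMathZ2012, proof of Theorem (2) (the image in GL₂(ℤ/4ℤ) surjects onto GL₂(ℤ/2ℤ))] -/
theorem exists_par_rhoMat_eq_of_two (h2 : W.HasSurjectiveModNGaloisRep 2) (p : P4)
    (hp : P4.det p = 1) : ∃ σ : Field.absoluteGaloisGroup K, par (rhoMat W e σ) = p := by
  have hg : (ofTup (liftP4 p)).det * (ofTup (liftP4 p)).det = 1 := by
    rw [det_eq, tup_ofTup]; exact liftP4_facts.2 p hp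
  obtain ⟨σ, hσ⟩ := exists_par_rhoMat_eq_par_of_two W e h2 _ hg
  refine ⟨σ, ?_⟩
  rw [hσ, show par (ofTup (liftP4 p)) = Q4.par (tup (ofTup (liftP4 p))) from rfl, tup_ofTup]
  exact liftP4_facts.1 p

/-! ### §3. Conversely: every automorphism of `E[2]` is the restriction of a matrix automorphism of
`E[4]`, so "every invertible matrix over `ℤ/4` is some `rhoMat σ`" gives `ρ̄₂` onto -/

/-- `red x = 0 ⟹ 2x = 0` in `ℤ/4`. [folklore] -/
private theorem two_mul_eq_zero_of_red {x : ZMod 4} (h : red x = 0) : 2 * x = 0 := by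
  revert x; decide

/-- **Every invertible matrix is some `rhoMat σ` ⟹ `ρ̄₂` onto** (every automorphism of `E[2]` is the
restriction of one of `E[4]`): for `β ∈ Aut(E[2])` write `e (β (2e⁻¹δ_j)) = 2 g_j`; the matrix
`g = (g₀ | g₁)` is invertible because `β` is injective, and `σ` with `rhoMat σ = g` restricts to `β`.
[cite: DokchitserDokchitserMathZ2012, proof of Theorem (2) (ρ̄₄ onto ⟹ ρ̄₂ onto)] -/
theorem hasSurjectiveModNGaloisRep_two_of_matrix
    (h : ∀ g : M4, g.det * g.det = 1 → ∃ σ : Field.absoluteGaloisGroup K, rhoMat W e σ = g) :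
    W.HasSurjectiveModNGaloisRep 2 := by
  intro β'
  set β : geomTorsion W 2 ≃+ geomTorsion W 2 := β'.toAdd with hβ
  -- the basis `Q_j = 2 e⁻¹ δ_j` of `E[2]` and the columns `g_j`
  have hQ : ∀ c : Fin 2 → ZMod 4,
      ((e.symm (2 • c) : geomTorsion W 4) : geomPoints W) ∈ geomTorsion W 2 :=
    fun c ↦ (mem_two_iff W _).mpr (two_nsmul_symm_two_nsmul W e c)
  -- `β` on `e⁻¹(2c)`, as an element of `E[4]`
  set B : (Fin 2 → ZMod 4) → geomTorsion W 4 := fun c ↦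
    ⟨(β ⟨_, hQ c⟩ : geomPoints W), mem_geomTorsion_four_of_two W (β ⟨_, hQ c⟩).2⟩ with hB
  have hBadd : ∀ c c', B (c + c') = B c + B c' := by
    intro c c'
    apply Subtype.ext
    change ((β _ : geomTorsion W 2) : geomPoints W) = (β _ : geomPoints W) + (β _ : geomPoints W)
    rw [← AddSubgroup.coe_add, ← map_add]
    congr 2
    apply Subtype.ext
    change ((e.symm (2 • (c + c')) : geomTorsion W 4) : geomPoints W) = _
    rw [smul_add, map_add]
    rfl
  have hB2 : ∀ c, 2 • B c = 0 := by
    intro c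
    rw [← mem_two_iff]
    exact (β ⟨_, hQ c⟩).2
  -- coordinates: `e (B δ_j) = 2 • g_j`
  choose col hcol using fun j : Fin 2 ↦ exists_eq_symm_two_nsmul_of_two W e (hB2 (Pi.single j 1))
  set g : M4 := Matrix.of fun i j ↦ col j i with hg
  have hBe : ∀ c : Fin 2 → ZMod 4, e (B c) = 2 • (g *ᵥ c) := by
    intro c
    have hc : c = (c 0).val • Pi.single 0 1 + (c 1).val • Pi.single 1 1 := by
      ext i; simp only [Pi.add_apply, Pi.smul_apply, Pi.single_apply]; fin_cases i <;> simp
    have hBn : ∀ (n : ℕ) (c : Fin 2 → ZMod 4), B (n • c) = n • B c := by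
      intro n c
      induction n with
      | zero =>
        simp only [zero_smul]
        apply Subtype.ext
        change ((β _ : geomTorsion W 2) : geomPoints W) = 0
        rw [show (⟨((e.symm (2 • (0 : Fin 2 → ZMod 4)) : geomTorsion W 4) : geomPoints W), hQ 0⟩ :
          geomTorsion W 2) = 0 from Subtype.ext (by simp), map_zero]
        rfl
      | succ n ih => rw [succ_nsmul, hBadd, ih, succ_nsmul]
    conv_lhs => rw [hc]
    rw [hBadd, hBn, hBn, map_add, map_nsmul, map_nsmul, hcol 0, hcol 1, e.apply_symm_apply,
      e.apply_symm_apply]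
    ext i
    simp only [Pi.add_apply, Pi.smul_apply]
    simp [hg, Matrix.mulVec, dotProduct, Fin.sum_univ_two, nsmul_eq_mul]
    ring
  -- `det g` is odd: otherwise `β` kills a nonzero `2`-torsion point
  have hdet : g.det * g.det = 1 := by
    rw [GaloisRepresentations.GL2Mod4.mul_self_eq_one_iff]
    by_contra hev
    have hev' : red g.det = 0 := by
      rcases (by decide : ∀ z : ZMod 2, z = 0 ∨ z = 1) (red g.det) with h0 | h1
      · exact h0
      · exact absurd h1 hev
    -- `β (e⁻¹ (2v)) = e⁻¹ (2 g v)`: if `g v ≡ 0 (mod 2)` then `2v = 0`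
    have key : ∀ v : Fin 2 → ZMod 4, 2 • (g *ᵥ v) = 0 → 2 • v = 0 := by
      intro v hv
      have h1 : e (B v) = 0 := by rw [hBe]; exact hv
      have h2 : B v = 0 := e.map_eq_zero_iff.mp h1
      have h3 : (⟨_, hQ v⟩ : geomTorsion W 2) = 0 := by
        apply β.injective
        rw [map_zero]
        apply Subtype.ext
        have h2' : ((B v : geomTorsion W 4) : geomPoints W) = 0 := congrArg Subtype.val h2
        exact h2'
      have h3' : ((e.symm (2 • v) : geomTorsion W 4) : geomPoints W) = 0 :=
        congrArg Subtype.val h3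
      have h4 : (e.symm (2 • v) : geomTorsion W 4) = 0 := Subtype.ext h3'
      rw [e.symm.map_eq_zero_iff] at h4
      exact h4
    -- the columns of `adj g` reduce `g` to `det g`: `g (adj g δ_j) = det g • δ_j`
    have hadj : ∀ j, 2 • (g *ᵥ (g.adjugate *ᵥ Pi.single j 1)) = 0 := by
      intro j
      rw [Matrix.mulVec_mulVec, Matrix.mul_adjugate, Matrix.smul_mulVec, Matrix.one_mulVec]
      ext i
      simp only [Pi.smul_apply, Pi.zero_apply, Pi.single_apply, smul_eq_mul, nsmul_eq_mul,
        Nat.cast_ofNat]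
      split_ifs
      · rw [mul_one, two_mul_eq_zero_of_red hev']
      · rw [mul_zero, mul_zero]
    have hcols : ∀ j i, 2 * g.adjugate i j = 0 := by
      intro j i
      have := congr_fun (key _ (hadj j)) i
      simpa [Matrix.mulVec, dotProduct, Pi.single_apply, Fin.sum_univ_two, nsmul_eq_mul] using this
    -- so all entries of `g` are even, and then `β (2 e⁻¹ δ₀) = 0` with `2 e⁻¹ δ₀ ≠ 0`
    have hg00 : 2 * g 0 0 = 0 := by simpa [Matrix.adjugate_fin_two] using hcols 1 1
    have hg10 : 2 * g 1 0 = 0 := by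
      have := hcols 0 1; simp [Matrix.adjugate_fin_two] at this; simpa using this
    have h5 : 2 • (Pi.single 0 1 : Fin 2 → ZMod 4) = 0 := by
      apply key
      ext i
      fin_cases i <;> simp [nsmul_eq_mul, hg00, hg10]
    have h6 := congr_fun h5 0
    simp [nsmul_eq_mul] at h6
    exact absurd h6 (by decide)
  -- the lift
  obtain ⟨σ, hσ⟩ := h g hdet
  refine ⟨σ, Multiplicative.toAdd.injective (AddEquiv.ext fun P ↦ ?_)⟩
  rw [← hβ]
  apply Subtype.ext
  rw [galoisRepTorsion_apply, AddSubgroup.torsionBy.coe_smul]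
  -- `P = e⁻¹(2c)` inside `E[4]`
  set P4' : geomTorsion W 4 := ⟨P, mem_geomTorsion_four_of_two W P.2⟩ with hP4'
  have hP2 : 2 • P4' = 0 := (mem_two_iff W P4').mp P.2
  obtain ⟨c, hc⟩ := exists_eq_symm_two_nsmul_of_two W e hP2
  have hPe : P = ⟨_, hQ c⟩ := Subtype.ext (by
    change (P4' : geomPoints W) = ((e.symm (2 • c) : geomTorsion W 4) : geomPoints W)
    exact congrArg Subtype.val hc)
  have hσP : e (σ • P4') = e (B c) := by
    rw [rhoMat_mulVec, hσ, hc, e.apply_symm_apply, hBe, Matrix.mulVec_smul]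
  have hσP' : σ • P4' = B c := e.injective hσP
  have := congrArg Subtype.val hσP'
  rw [AddSubgroup.torsionBy.coe_smul] at this
  rw [this, hB, hPe]

include e in
/-- **`ρ̄_{E,4}` onto ⟹ `ρ̄_{E,2}` onto.**
[cite: DokchitserDokchitserMathZ2012, proof of Theorem (2) (ρ̄₄ onto ⟹ ρ̄₂ onto)] -/
theorem hasSurjectiveModNGaloisRep_two_of_four (h4 : W.HasSurjectiveModNGaloisRep 4) :
    W.HasSurjectiveModNGaloisRep 2 := by
  apply hasSurjectiveModNGaloisRep_two_of_matrix W e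
  intro g hg
  exact (hasSurjectiveModNGaloisRep_iff_matrix W e).mp h4 g ⟨g.det, hg⟩

end Four

end Literature.NumberTheory.EllipticCurves.DokchitserDokchitser2012

end
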